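import Summits.QuantumFields.YangMills.Theorems.BalabanUVNodesN15KingModelCoverFineOperator
import Summits.QuantumFields.YangMills.Theorems.BalabanUVNodesN15KingModelToronBlockCovariance
import HarnessLib

/-!
# BalabanUVNodes ∕ N15 — THE KING-MODEL RUNG (PART Ͻ-e): FINITE COVERS — KING's BLOCK-SPIN OBJECTS AT A TORON DESCEND: the covariant block mean `Q^ω`, its adjoint `Q^{ω*}`,
# the full fine operator `A₀(ω) = (−cΔ_ω + m²) + aQ^{ω*}Q^ω`, its inverse (King's full propagator), the effective Laplacian `Δ^ω_eff = a − a²Q^ωG(ω)Q^{ω*}` ((2.14)∕(4.5)) and the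
# block-field covariance `(Δ^ω_eff)⁻¹` all LIFT along the covering `(T_{NM′} → T_{NM}, T_{M′} → T_M)`; so `(Δ^ω_eff)⁻¹` ON `T_M` IS THE FINITE IMAGE SUM OF `(Δ^ω_eff)⁻¹` ON `T_{M′}`
# (Track A, DAG node N15 = NE2; FAN-OUT v1.1 §N15 s3 «KING-MODEL RUNG … + what the curved case adds»; count-neutral)

HONEST FRAMING.  Count-neutral (cell `pub-ymgap`, seat `pub-ymgap-dag-n15-e` g45; `--supports stmt-QuantumFields-27247 --as helper` = K3ᴬ, KEY MAP v3).  King's `A = 0`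
comparison model [King1986] at a constant abelian (flat) link field: PART Ͷ-k's `fineOpTw`∕`effLapTw` built from the tree's twisted block mean `B5ToronOperators118.QsOpTw`
([Balaban1985BackgroundPropagators] (3.19) p.393 at a constant background; King's (2.11)–(2.12) p.653 with straight contours).  Exact finite-dimensional identities on finite tori;
NOT Bałaban's `G_k(U)`; NOT a node discharge (N15 of record untouched); nothing continuum ∕ ℝ⁴ ∕ OS ∕ Clay.

THE MATHEMATICS.  King's blocks descend to King's blocks (Ͻ-b `proj_bpt`): the block point `Nỹ + j` over `ỹ ∈ T_{M′}` projects to `N·π(ỹ) + j`.  Hence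
`(Q^ω(f ∘ π_fine))(ỹ) = N^{−(d+1)}Σ_j ω^j f(π_fine(Nỹ + j)) = (Q^ωf)(π ỹ)` — `Q^ω` on the cover LIFTS `Q^ω` on the base (output coarse, input fine); for the adjoint one reads
the kernel at a block point, `Q^ω(y, Nb + j) = [y = b]·ω^j N^{−(d+1)}` (`QsOpTw_apply_bpt`, King's block parametrisation is a bijection), so `(Q^ω)ᴴ` lifts `(Q^ω)ᴴ` (output fine,
input coarse).  PART Ͻ-a's algebra of lifts then carries `A₀(ω)`, `G(ω) = A₀(ω)⁻¹`, `Δ^ω_eff` and `(Δ^ω_eff)⁻¹` (Ͷ-k∕Ͷ-n: all invertible for unit `ω`, `a > 0`, `c ≥ 0`, `m² > 0`)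
down the covering, and the image sum reads: `(Δ^ω_eff)⁻¹_{T_M}(π b̃, b′) = Σ_{b̃′ : π b̃′ = b′} (Δ^ω_eff)⁻¹_{T_{M′}}(b̃, b̃′)` — King's block-field covariance at a toron on the small
unit torus is the periodisation of the one on the covering unit torus (method of images, finite-cover form — an elementary device of these files).
PROVED HERE:
* §1 `QsOpTw_apply_bpt` (the kernel at a block point), `conjTranspose_QsOpTw_mulVec_bpt`, ★★ **`QsOpTw_lifts`**, ★★ **`QsOpTw_conjTranspose_lifts`**, `kingQadjTw_lifts`;
* §2 ★★ `fineOpTw_lifts`, ★★ `fineOpTw_inv_lifts` (King's full propagator descends), `fineOpTw_inv_apply_eq_sum_cover`, ★★★ **`effLapTw_lifts`** ((2.14)∕(4.5) descends), ★★★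
  **`effLapTw_inv_lifts`**, ★★★ **`effLapTw_inv_apply_eq_sum_cover`** (the block-field covariance at a toron is a finite image sum), `effLapTw_inv_apply_eq_sum_cover'` (canonical
  lift), ★ `norm_effLapTw_inv_apply_le_of_cover` (fibrewise majorants descend), `effLapTw_apply_eq_sum_cover` (the effective Laplacian's own kernel periodises too).
PRIOR TREE ART (by name): Ͻ-a (`Lifts`, `.mul`, `.add`, `.sub`, `.smul`, `.inv`, `.one`, `.apply_eq_sum_fiber`, `.norm_apply_le_sum`), Ͻ-b (`proj`, `fineDvd`, `proj_bpt`, `exists_bpt_eq`,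
`bpt_eq_bpt_iff`, `proj_surjective`, `lift`, `proj_lift`), Ͻ-c (`toronOp_lifts`), Ͷ-k (`kingQadjTw`, `fineOpTw`, `effLapTw`, `isUnit_fineOpTw`), Ͷ-n (`isUnit_effLapTw`),
`B5ToronOperators118` (`QsOpTw`, `QsOpTw_mulVec`, `twPow`), `B5Block118` (`bpt`).  Dedup (rg at filing): basename 0 files; needles `QsOpTw_lifts|effLapTw_lifts|effLapTw_inv_apply_eq_sum_cover|
QsOpTw_apply_bpt` 0 tree files.  presearch: n/a (composition of in-tree theorems).  Locators: [King1986] (2.11)–(2.14) p.653, (4.1)–(4.5) p.670;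
[Balaban1985BackgroundPropagators] (3.19) p.393; [Balaban1984PropagatorsI] (1.18)∕(1.20) p.20, (1.29) p.23.  0 `sorry`, 0 `def`.
v1.1 (DOC-ONLY, ERRATUM-Ͻ1 = ref-I READ-1034 N2): v1.0 cited «[King1986] §4 p.670 l.8–13» as «the method of images»; King's lines invoke [Ba 4]'s MULTIPLE-REFLECTION
representations (box propagators ∕ free boundary conditions ∕ the (2.13) operator on `ηℤ^d`, `A = 0`), not a periodisation — the finite-cover image sum is an elementary device of these files
([folklore]); that locator is withdrawn from the affected docstrings, every other locator stands; declarations byte-identical to v1.0.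
-/

noncomputable section

open scoped BigOperators ComplexConjugate ComplexOrder
open Finset Matrix

namespace Summit.QuantumFields.YangMills.BalabanUVNodes.N15KingModelRung.Cover

open Literature.MathematicalPhysics.QuantumFieldTheory.Balaban1983to89.B5Prop11Plancherel (Tor unitVec fine)
open Literature.MathematicalPhysics.QuantumFieldTheory.Balaban1983to89.B5Block118 (bpt)
open Literature.MathematicalPhysics.QuantumFieldTheory.Balaban1983to89.B5ToronOperators118 (QsOpTw QsOpTw_mulVec twPow)
open Summit.QuantumFields.YangMills.BalabanUVNodes.N15KingModelRung.Toron (toronOp kingQadjTw fineOpTw effLapTw isUnit_fineOpTw isUnit_effLapTw)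

variable {d : ℕ} (N : ℕ) [NeZero N] {M M' : Fin (d + 1) → ℕ} [hM : ∀ μ, NeZero (M μ)] [hM' : ∀ μ, NeZero (M' μ)]

/-! ## §1 The twisted block mean and its adjoint descend -/

omit hM' in
/-- THE KERNEL OF `Q^ω` AT A BLOCK POINT: `Q^ω(y, Nb + j) = [y = b]·ω^j·N^{−(d+1)}` (King's block parametrisation `(b, j) ↦ Nb + j` is a bijection).
[cite: Balaban1985BackgroundPropagators, (3.19) p.393; King1986, (2.11) p.653] -/
theorem QsOpTw_apply_bpt (ω : Fin (d + 1) → ℂ) (y b : Tor M) (j : Fin (d + 1) → Fin N) :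
    QsOpTw N M ω y (bpt N M b j) = if y = b then twPow N ω j / (N : ℂ) ^ (d + 1) else 0 := by
  simp only [QsOpTw]
  have hiff : ∀ j' : Fin (d + 1) → Fin N, (bpt N M b j = bpt N M y j') ↔ (y = b ∧ j' = j) := fun j' => by
    rw [bpt_eq_bpt_iff N b y j j']; constructor <;> rintro ⟨h1, h2⟩ <;> exact ⟨h1.symm, h2.symm⟩
  simp_rw [hiff]
  by_cases hy : y = b
  · simp only [hy, true_and, if_true]
    rw [Finset.sum_ite_eq' Finset.univ j, if_pos (Finset.mem_univ _)]
  · simp only [hy, false_and, if_false, Finset.sum_const_zero]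

omit hM' in
/-- `(Q^ω)ᴴ` on a coarse function, read at a block point: `((Q^ω)ᴴg)(Nb + j) = conj(ω^jN^{−(d+1)})·g(b)`. [cite: Balaban1985BackgroundPropagators, (3.19) p.393; King1986, (2.13) p.653] -/
theorem conjTranspose_QsOpTw_mulVec_bpt (ω : Fin (d + 1) → ℂ) (g : Tor M → ℂ) (b : Tor M) (j : Fin (d + 1) → Fin N) :
    ((QsOpTw N M ω)ᴴ *ᵥ g) (bpt N M b j) = conj (twPow N ω j / (N : ℂ) ^ (d + 1)) * g b := by
  simp only [Matrix.mulVec, dotProduct, Matrix.conjTranspose_apply, QsOpTw_apply_bpt, Complex.star_def]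
  rw [Finset.sum_eq_single b (fun y _ hy => by rw [if_neg hy, map_zero, zero_mul]) (fun h => absurd (Finset.mem_univ b) h), if_pos rfl]

/-- ★★ **THE COVARIANT BLOCK MEAN DESCENDS** (output: unit lattice, input: fine lattice): `Q^ω_{cover}·(f ∘ π_fine) = (Q^ωf) ∘ π` for every covering `T_{M′} → T_M` (`M_μ ∣ M′_μ`)
and every phase vector `ω`. [cite: King1986, (2.11) p.653; Balaban1985BackgroundPropagators, (3.19) p.393] -/
theorem QsOpTw_lifts (h : ∀ μ, M μ ∣ M' μ) (ω : Fin (d + 1) → ℂ) :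
    Lifts (proj h) (proj (fineDvd N h)) (QsOpTw N M' ω) (QsOpTw N M ω) := by
  intro f; funext y
  change (QsOpTw N M' ω *ᵥ (f ∘ proj (fineDvd N h))) y = (QsOpTw N M ω *ᵥ f) (proj h y)
  rw [QsOpTw_mulVec, QsOpTw_mulVec]
  simp only [Function.comp_apply, proj_bpt N h]

/-- ★★ **ITS ADJOINT DESCENDS** (output: fine lattice, input: unit lattice): `(Q^ω_{cover})ᴴ·(g ∘ π) = ((Q^ω)ᴴg) ∘ π_fine`. [cite: King1986, (2.13) p.653; Balaban1984PropagatorsI, (1.74) p.30] -/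
theorem QsOpTw_conjTranspose_lifts (h : ∀ μ, M μ ∣ M' μ) (ω : Fin (d + 1) → ℂ) :
    Lifts (proj (fineDvd N h)) (proj h) (QsOpTw N M' ω)ᴴ (QsOpTw N M ω)ᴴ := by
  intro g; funext x
  obtain ⟨b, j, rfl⟩ := exists_bpt_eq N (M := M') x
  change ((QsOpTw N M' ω)ᴴ *ᵥ (g ∘ proj h)) (bpt N M' b j) = ((QsOpTw N M ω)ᴴ *ᵥ g) (proj (fineDvd N h) (bpt N M' b j))
  rw [conjTranspose_QsOpTw_mulVec_bpt, proj_bpt N h, conjTranspose_QsOpTw_mulVec_bpt]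
  rfl

/-- King's `η`-adjoint `Q^{ω*} = N^{d+1}(Q^ω)ᴴ` descends. [cite: King1986, (2.13) p.653; Balaban1984PropagatorsI, (1.74) p.30] -/
theorem kingQadjTw_lifts (h : ∀ μ, M μ ∣ M' μ) (ω : Fin (d + 1) → ℂ) :
    Lifts (proj (fineDvd N h)) (proj h) (kingQadjTw N M' ω) (kingQadjTw N M ω) :=
  (QsOpTw_conjTranspose_lifts N h ω).smul _

/-! ## §2 King's full propagator, effective Laplacian and block-field covariance at a toron descend -/

/-- ★★ **KING's FULL FINE OPERATOR AT THE TORON DESCENDS**: `A₀(ω) = (−cΔ_ω + m²) + aQ^{ω*}Q^ω` on the cover lifts `A₀(ω)` on the base. [cite: King1986, (2.13) p.653] -/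
theorem fineOpTw_lifts (h : ∀ μ, M μ ∣ M' μ) (a c m2 : ℝ) (ω : Fin (d + 1) → ℂ) :
    Lifts (proj (fineDvd N h)) (proj (fineDvd N h)) (fineOpTw N M' a c m2 ω) (fineOpTw N M a c m2 ω) :=
  (toronOp_lifts (fineDvd N h) c m2 ω).add (((kingQadjTw_lifts N h ω).mul (QsOpTw_lifts N h ω)).smul _)

/-- ★★ **KING's FULL PROPAGATOR `G(ω) = A₀(ω)⁻¹` DESCENDS** (unit `ω`, `a ≥ 0`, `c ≥ 0`, `m² > 0`). [cite: King1986, (2.13) p.653] -/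
theorem fineOpTw_inv_lifts (h : ∀ μ, M μ ∣ M' μ) {a c m2 : ℝ} (ha : 0 ≤ a) (hc : 0 ≤ c) (hm : 0 < m2) {ω : Fin (d + 1) → ℂ} (hω : ∀ μ, ‖ω μ‖ = 1) :
    Lifts (proj (fineDvd N h)) (proj (fineDvd N h)) (fineOpTw N M' a c m2 ω)⁻¹ (fineOpTw N M a c m2 ω)⁻¹ :=
  (fineOpTw_lifts N h a c m2 ω).inv (proj_surjective _) (isUnit_fineOpTw N M' ha hc hm hω)

/-- The full propagator on the base fine torus is the image sum of the one on the cover. [cite: King1986, (2.13) p.653] -/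
theorem fineOpTw_inv_apply_eq_sum_cover (h : ∀ μ, M μ ∣ M' μ) {a c m2 : ℝ} (ha : 0 ≤ a) (hc : 0 ≤ c) (hm : 0 < m2) {ω : Fin (d + 1) → ℂ} (hω : ∀ μ, ‖ω μ‖ = 1)
    (x' : Tor (fine N M')) (y : Tor (fine N M)) :
    (fineOpTw N M a c m2 ω)⁻¹ (proj (fineDvd N h) x') y = ∑ y' ∈ fiber (proj (fineDvd N h)) y, (fineOpTw N M' a c m2 ω)⁻¹ x' y' :=
  (fineOpTw_inv_lifts N h ha hc hm hω).apply_eq_sum_fiber x' y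

/-- ★★★ **KING's EFFECTIVE LAPLACIAN AT THE TORON DESCENDS**: `Δ^ω_eff = a − a²Q^ωG(ω)Q^{ω*}` ((2.14)∕(4.5)) on the covering unit torus `T_{M′}` lifts `Δ^ω_eff` on `T_M`.
[cite: King1986, (2.14) p.653, (4.5) p.670] -/
theorem effLapTw_lifts (h : ∀ μ, M μ ∣ M' μ) {a c m2 : ℝ} (ha : 0 ≤ a) (hc : 0 ≤ c) (hm : 0 < m2) {ω : Fin (d + 1) → ℂ} (hω : ∀ μ, ‖ω μ‖ = 1) :
    Lifts (proj h) (proj h) (effLapTw N M' a c m2 ω) (effLapTw N M a c m2 ω) := by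
  unfold effLapTw
  exact ((Lifts.one (proj h)).smul _).sub ((((QsOpTw_lifts N h ω).mul (fineOpTw_inv_lifts N h ha hc hm hω)).mul (kingQadjTw_lifts N h ω)).smul _)

/-- The kernel of the effective Laplacian itself periodises: `Δ^ω_eff(π b̃, b′) = Σ_{fibre} Δ^ω_eff(b̃, b̃′)`. [cite: King1986, (4.5) p.670] -/
theorem effLapTw_apply_eq_sum_cover (h : ∀ μ, M μ ∣ M' μ) {a c m2 : ℝ} (ha : 0 ≤ a) (hc : 0 ≤ c) (hm : 0 < m2) {ω : Fin (d + 1) → ℂ} (hω : ∀ μ, ‖ω μ‖ = 1)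
    (b' : Tor M') (b : Tor M) :
    effLapTw N M a c m2 ω (proj h b') b = ∑ b'' ∈ fiber (proj h) b, effLapTw N M' a c m2 ω b' b'' :=
  (effLapTw_lifts N h ha hc hm hω).apply_eq_sum_fiber b' b

/-- ★★★ **THE BLOCK-FIELD COVARIANCE AT THE TORON DESCENDS**: `(Δ^ω_eff)⁻¹` on `T_{M′}` lifts `(Δ^ω_eff)⁻¹` on `T_M` (`a > 0`, `c ≥ 0`, `m² > 0`, unit `ω`).
[cite: King1986, (2.16) p.653, (4.38) p.674] -/
theorem effLapTw_inv_lifts (h : ∀ μ, M μ ∣ M' μ) {a c m2 : ℝ} (ha : 0 < a) (hc : 0 ≤ c) (hm : 0 < m2) {ω : Fin (d + 1) → ℂ} (hω : ∀ μ, ‖ω μ‖ = 1) :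
    Lifts (proj h) (proj h) (effLapTw N M' a c m2 ω)⁻¹ (effLapTw N M a c m2 ω)⁻¹ :=
  (effLapTw_lifts N h ha.le hc hm hω).inv (proj_surjective h) (isUnit_effLapTw N M' ha hc hm hω)

/-- ★★★ **THE METHOD OF IMAGES FOR KING's BLOCK-FIELD COVARIANCE AT A TORON**: `(Δ^ω_eff)⁻¹_{T_M}(π b̃, b′) = Σ_{b̃′ : π b̃′ = b′} (Δ^ω_eff)⁻¹_{T_{M′}}(b̃, b̃′)` — the unit-lattice
covariance on the small torus is the periodisation of the one on the covering unit torus. [cite: King1986, (2.16) p.653, (4.38) p.674; Balaban1984PropagatorsI, (1.29) p.23] -/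
theorem effLapTw_inv_apply_eq_sum_cover (h : ∀ μ, M μ ∣ M' μ) {a c m2 : ℝ} (ha : 0 < a) (hc : 0 ≤ c) (hm : 0 < m2) {ω : Fin (d + 1) → ℂ} (hω : ∀ μ, ‖ω μ‖ = 1)
    (b' : Tor M') (b : Tor M) :
    (effLapTw N M a c m2 ω)⁻¹ (proj h b') b = ∑ b'' ∈ fiber (proj h) b, (effLapTw N M' a c m2 ω)⁻¹ b' b'' :=
  (effLapTw_inv_lifts N h ha hc hm hω).apply_eq_sum_fiber b' b

/-- The same with the canonical lift of the base point. [folklore] -/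
theorem effLapTw_inv_apply_eq_sum_cover' (h : ∀ μ, M μ ∣ M' μ) {a c m2 : ℝ} (ha : 0 < a) (hc : 0 ≤ c) (hm : 0 < m2) {ω : Fin (d + 1) → ℂ} (hω : ∀ μ, ‖ω μ‖ = 1)
    (b₀ b : Tor M) :
    (effLapTw N M a c m2 ω)⁻¹ b₀ b = ∑ b'' ∈ fiber (proj h) b, (effLapTw N M' a c m2 ω)⁻¹ (lift h b₀) b'' := by
  conv_lhs => rw [← proj_lift h b₀]
  exact effLapTw_inv_apply_eq_sum_cover N h ha hc hm hω (lift h b₀) b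

/-- The fibre sums do not depend on the lift. [folklore] -/
theorem effLapTw_inv_sum_fiber_indep (h : ∀ μ, M μ ∣ M' μ) {a c m2 : ℝ} (ha : 0 < a) (hc : 0 ≤ c) (hm : 0 < m2) {ω : Fin (d + 1) → ℂ} (hω : ∀ μ, ‖ω μ‖ = 1)
    {b' b'' : Tor M'} (hb : proj h b' = proj h b'') (b : Tor M) :
    ∑ z ∈ fiber (proj h) b, (effLapTw N M' a c m2 ω)⁻¹ b' z = ∑ z ∈ fiber (proj h) b, (effLapTw N M' a c m2 ω)⁻¹ b'' z :=
  (effLapTw_inv_lifts N h ha hc hm hω).sum_fiber_indep hb b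

/-- ★ FIBREWISE MAJORANTS DESCEND: an entrywise bound `‖(Δ^ω_eff)⁻¹_{T_{M′}}(b̃, b̃′)‖ ≤ F(b̃, b̃′)` on the cover gives `‖(Δ^ω_eff)⁻¹_{T_M}(π b̃, b)‖ ≤ Σ_{fibre}F` on the base.
[cite: King1986, (4.38) p.674] -/
theorem norm_effLapTw_inv_apply_le_of_cover (h : ∀ μ, M μ ∣ M' μ) {a c m2 : ℝ} (ha : 0 < a) (hc : 0 ≤ c) (hm : 0 < m2) {ω : Fin (d + 1) → ℂ} (hω : ∀ μ, ‖ω μ‖ = 1)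
    {F : Tor M' → Tor M' → ℝ} (hF : ∀ b' b'', ‖(effLapTw N M' a c m2 ω)⁻¹ b' b''‖ ≤ F b' b'') (b' : Tor M') (b : Tor M) :
    ‖(effLapTw N M a c m2 ω)⁻¹ (proj h b') b‖ ≤ ∑ b'' ∈ fiber (proj h) b, F b' b'' :=
  (effLapTw_inv_lifts N h ha hc hm hω).norm_apply_le_sum hF b' b

/-- DIFFERENCES DESCEND: for two spacings `N₁, N₂` (or any two toron block objects on the same unit tori), the difference of the base covariances is the image sum of the
difference of the cover covariances — the form in which King's two-spacing rate (Lemma 4.5 (4.38)) will be transferred (PART Ͻ-h). [cite: King1986, (4.38) p.674] -/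
theorem effLapTw_inv_sub_apply_eq_sum_cover (N₁ N₂ : ℕ) [NeZero N₁] [NeZero N₂] (h : ∀ μ, M μ ∣ M' μ) {a₁ a₂ c₁ c₂ m2 : ℝ} (ha₁ : 0 < a₁) (ha₂ : 0 < a₂)
    (hc₁ : 0 ≤ c₁) (hc₂ : 0 ≤ c₂) (hm : 0 < m2) {ω₁ ω₂ : Fin (d + 1) → ℂ} (hω₁ : ∀ μ, ‖ω₁ μ‖ = 1) (hω₂ : ∀ μ, ‖ω₂ μ‖ = 1) (b' : Tor M') (b : Tor M) :
    (effLapTw N₁ M a₁ c₁ m2 ω₁)⁻¹ (proj h b') b - (effLapTw N₂ M a₂ c₂ m2 ω₂)⁻¹ (proj h b') b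
      = ∑ b'' ∈ fiber (proj h) b, ((effLapTw N₁ M' a₁ c₁ m2 ω₁)⁻¹ b' b'' - (effLapTw N₂ M' a₂ c₂ m2 ω₂)⁻¹ b' b'') := by
  have hl := (effLapTw_inv_lifts N₁ h ha₁ hc₁ hm hω₁).sub (effLapTw_inv_lifts N₂ h ha₂ hc₂ hm hω₂)
  have := hl.apply_eq_sum_fiber b' b
  simpa only [Matrix.sub_apply] using this

/-- ★ A fibrewise majorant of the DIFFERENCE on the cover bounds the difference on the base. [cite: King1986, (4.38) p.674] -/
theorem norm_effLapTw_inv_sub_apply_le_of_cover (N₁ N₂ : ℕ) [NeZero N₁] [NeZero N₂] (h : ∀ μ, M μ ∣ M' μ) {a₁ a₂ c₁ c₂ m2 : ℝ} (ha₁ : 0 < a₁) (ha₂ : 0 < a₂)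
    (hc₁ : 0 ≤ c₁) (hc₂ : 0 ≤ c₂) (hm : 0 < m2) {ω₁ ω₂ : Fin (d + 1) → ℂ} (hω₁ : ∀ μ, ‖ω₁ μ‖ = 1) (hω₂ : ∀ μ, ‖ω₂ μ‖ = 1)
    {F : Tor M' → Tor M' → ℝ} (hF : ∀ b' b'', ‖(effLapTw N₁ M' a₁ c₁ m2 ω₁)⁻¹ b' b'' - (effLapTw N₂ M' a₂ c₂ m2 ω₂)⁻¹ b' b''‖ ≤ F b' b'') (b' : Tor M') (b : Tor M) :
    ‖(effLapTw N₁ M a₁ c₁ m2 ω₁)⁻¹ (proj h b') b - (effLapTw N₂ M a₂ c₂ m2 ω₂)⁻¹ (proj h b') b‖ ≤ ∑ b'' ∈ fiber (proj h) b, F b' b'' := by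
  rw [effLapTw_inv_sub_apply_eq_sum_cover N₁ N₂ h ha₁ ha₂ hc₁ hc₂ hm hω₁ hω₂]
  exact (norm_sum_le _ _).trans (Finset.sum_le_sum fun b'' _ => hF b' b'')

end Summit.QuantumFields.YangMills.BalabanUVNodes.N15KingModelRung.Cover

end
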